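import Literature.MathematicalPhysics.KineticTheory.LangevinChainKernel
import Literature.MathematicalPhysics.KineticTheory.LangevinChainNoiseContinuity
import Literature.MathematicalPhysics.KineticTheory.LangevinChainNESSProofs
import Literature.Probability.Process.BrownianSupTail

/-!
# Helper 6 for stub `stub_bondHeatVarianceContinuity` (crux ★ `LinearResponseFTUR`, stmt-AtomisticToContinuum-9122):
# the transition kernels depend continuously on the bath temperatures, uniformly on energy shells

Support file for line `lebesgue-flip-duality`, stub K6b (H3 of the stub plan). For the pinned chain
(`ω₂ > 0`, `lam, β, γ ≥ 0`), a continuous compactly supported observable `g`, an energy level `R`, a time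
`r ≥ 0` and `ε > 0`, there is `δ₀ > 0` with
`|E g(Φ^{T+δ/2,T-δ/2}_r(z, B)) - E g(Φ^{T,T}_r(z, B))| ≤ ε` for all `|δ| < δ₀` and all `H(z) ≤ R`
(`pinnedChain_integral_solMap_tendsto_temperature`). Proof: on the event
`{sup_{s ≤ r} |B^i_s| ≤ M_w}` (whose complement is small, `measure_compl_goodEvent_le`) the two noise paths
`√(2γT_b) B^b` are bounded and uniformly close, so the flows are uniformly close
(`pinnedChain_exists_norm_chainFlow_sub_lt`) and `g` is uniformly continuous; off it `g` is bounded.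
Nothing here closes an item.
-/

noncomputable section

namespace Summit.AtomisticToContinuum.FouriersLaw.Theorems.LinearResponseFTUR

open MeasureTheory ProbabilityTheory Filter Topology Set Metric
open scoped NNReal ENNReal Topology
open Literature.MathematicalPhysics.KineticTheory.HeatConduction Literature.Probability.Process OscillatorChain

/-- On the good event `{sup_{s ≤ h} |B^i_s| ≤ M_w}` two noise paths with different amplitudes differ by at
most `(|c_L - c_L'| + |c_R - c_R'|) M_w` on `[0, h]`. [folklore] -/
private theorem norm_chainNoise_sub_le {N : ℕ} {Mw : ℝ} {h : ℝ≥0} {ω : WienerPair} (hω : ω ∈ goodEvent Mw h)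
    (c_L c_R c_L' c_R' : ℝ) {s : ℝ} (hs : s ≤ h) :
    ‖chainNoise N c_L c_R (pairPath ω) s - chainNoise N c_L' c_R' (pairPath ω) s‖ ≤
      (|c_L - c_L'| + |c_R - c_R'|) * Mw := by
  have hgood := abs_brownian_toNNReal_le_of_mem_goodEvent hω hs
  have hMw : 0 ≤ Mw := (abs_nonneg _).trans hgood.1
  refine (pi_norm_le_iff_of_nonneg (by positivity)).2 fun i => ?_
  rw [Pi.sub_apply, chainNoise_pairPath, chainNoise_pairPath, Real.norm_eq_abs]
  have e : (if i.val = 0 then c_L else 0) * brownian s.toNNReal ω.1 +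
      (if i.val = N - 1 then c_R else 0) * brownian s.toNNReal ω.2 -
      ((if i.val = 0 then c_L' else 0) * brownian s.toNNReal ω.1 +
        (if i.val = N - 1 then c_R' else 0) * brownian s.toNNReal ω.2) =
      (if i.val = 0 then c_L - c_L' else 0) * brownian s.toNNReal ω.1 +
        (if i.val = N - 1 then c_R - c_R' else 0) * brownian s.toNNReal ω.2 := by
    split_ifs <;> ring
  rw [e]
  refine (abs_add_le _ _).trans ?_
  rw [abs_mul, abs_mul, add_mul]
  refine add_le_add ?_ ?_
  · by_cases h0 : i.val = 0
    · rw [if_pos h0]; exact mul_le_mul_of_nonneg_left hgood.1 (abs_nonneg _)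
    · rw [if_neg h0, abs_zero, zero_mul]; positivity
  · by_cases h1 : i.val = N - 1
    · rw [if_pos h1]; exact mul_le_mul_of_nonneg_left hgood.2 (abs_nonneg _)
    · rw [if_neg h1, abs_zero, zero_mul]; positivity

/-- **The transition kernels are continuous in the bath temperatures, uniformly on energy shells**
(registered sub-goal of `stub_bondHeatVarianceContinuity`, H3 of its plan): for the pinned chain (`ω₂ > 0`,
`lam, β, γ ≥ 0`), `T > 0`, a continuous compactly supported `g`, `R`, `r ≥ 0` and `ε > 0` there is `δ₀ > 0`
such that `|E g(Φ^{T+δ/2,T-δ/2}_r(z,B)) - E g(Φ^{T,T}_r(z,B))| ≤ ε` whenever `|δ| < δ₀` and `H(z) ≤ R`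
(the flow is Lipschitz in the noise path on the event of bounded Brownian increments, whose complement is
small). [folklore] -/
theorem pinnedChain_integral_solMap_tendsto_temperature :
    ∀ ω₂ lam β γ : ℝ, 0 < ω₂ → 0 ≤ lam → 0 ≤ β → 0 ≤ γ → ∀ (N : ℕ) (T : ℝ), 0 < T →
    ∀ g : PhaseSpace N → ℝ, Continuous g → HasCompactSupport g →
    ∀ (R r : ℝ), 0 ≤ r → ∀ ε : ℝ, 0 < ε →
      ∃ δ₀ : ℝ, 0 < δ₀ ∧ ∀ δ : ℝ, |δ| < δ₀ →
        ∀ z : PhaseSpace N, (pinnedChain ω₂ lam β γ).hamiltonian N z ≤ R →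
          |(∫ ω, g ((pinnedChain ω₂ lam β γ).solMap N (T + δ / 2) (T - δ / 2) r z (pairPath ω)) ∂wienerPair) -
            ∫ ω, g ((pinnedChain ω₂ lam β γ).solMap N T T r z (pairPath ω)) ∂wienerPair| ≤ ε := by
  intro ω₂ lam β γ hω hl hβ hγ N T hT g hg hgc R r hr ε hε
  set P := pinnedChain ω₂ lam β γ with hP
  have hPγ : P.γ = γ := rfl
  -- `g` is bounded and uniformly continuous
  obtain ⟨G₀, hG₀⟩ := hg.bounded_above_of_compact_support hgc
  set G : ℝ := max G₀ 0 with hGdef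
  have hG0 : 0 ≤ G := le_max_right _ _
  have hG : ∀ x, |g x| ≤ G := fun x => by rw [← Real.norm_eq_abs]; exact (hG₀ x).trans (le_max_left _ _)
  have hguc : UniformContinuous g := hgc.uniformContinuous_of_continuous hg
  obtain ⟨ε₁, hε₁, hε₁g⟩ := Metric.uniformContinuous_iff.1 hguc (ε / 2) (by positivity)
  -- the good event: bounded Brownian paths on `[0, r]`
  set η : ℝ := ε / (4 * (G + 1)) with hηdef
  have hη0 : 0 < η := by positivity
  set r' : ℝ≥0 := r.toNNReal with hr'
  have hr'c : ((r' : ℝ≥0) : ℝ) = r := Real.coe_toNNReal r hr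
  obtain ⟨Mw, hMw0, hMwr, hMwη⟩ : ∃ a : ℝ, 0 ≤ a ∧ r < a ^ 2 ∧ 2 * (2 * r ^ 2 / (a ^ 2 - r) ^ 2) ≤ η := by
    have h1 : Tendsto (fun a : ℝ => a ^ 2 - r) atTop atTop :=
      tendsto_atTop_add_const_right _ (-r) (tendsto_pow_atTop two_ne_zero)
    have h2 : Tendsto (fun a : ℝ => (a ^ 2 - r) ^ 2) atTop atTop := (tendsto_pow_atTop two_ne_zero).comp h1
    have h3 : Tendsto (fun a : ℝ => 2 * (2 * r ^ 2) * ((a ^ 2 - r) ^ 2)⁻¹) atTop (𝓝 0) := by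
      simpa using h2.inv_tendsto_atTop.const_mul (2 * (2 * r ^ 2))
    have hev : ∀ᶠ a : ℝ in atTop, 0 ≤ a ∧ r < a ^ 2 ∧ 2 * (2 * r ^ 2) * ((a ^ 2 - r) ^ 2)⁻¹ < η :=
      (eventually_ge_atTop 0).and ((h1.eventually (eventually_gt_atTop 0)).mono (fun a ha => by linarith) |>.and
        (h3.eventually (gt_mem_nhds hη0)))
    obtain ⟨a, ha0, har, haη⟩ := hev.exists
    refine ⟨a, ha0, har, ?_⟩
    have : 2 * (2 * r ^ 2 / (a ^ 2 - r) ^ 2) = 2 * (2 * r ^ 2) * ((a ^ 2 - r) ^ 2)⁻¹ := by ring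
    rw [this]
    exact haη.le
  set bad : Set WienerPair := (goodEvent Mw r')ᶜ with hbad
  have hbadm : MeasurableSet bad := (measurableSet_goodEvent Mw r').compl
  have hbadle : wienerPair bad ≤ ENNReal.ofReal η := by
    have h := measure_compl_goodEvent_le hMw0 r' (by rw [hr'c]; exact hMwr)
    rw [hr'c] at h
    refine h.trans ?_
    rw [← ENNReal.ofReal_ofNat, ← ENNReal.ofReal_mul (by norm_num)]
    exact ENNReal.ofReal_le_ofReal hMwη
  have hbadreal : wienerPair.real bad ≤ η := ENNReal.toReal_le_of_le_ofReal hη0.le hbadle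
  -- amplitudes on the box `|δ| ≤ T` and the noise bound on the good event
  set c : ℝ → ℝ := fun a => Real.sqrt (2 * P.γ * a) with hc
  set Cmax : ℝ := Real.sqrt (2 * γ * (2 * T)) with hCmax
  have hCmax0 : 0 ≤ Cmax := Real.sqrt_nonneg _
  have hcle : ∀ a : ℝ, a ≤ 2 * T → |c a| ≤ Cmax := fun a ha => by
    simp only [hc, hPγ]
    rw [abs_of_nonneg (Real.sqrt_nonneg _)]
    exact Real.sqrt_le_sqrt (by nlinarith only [ha, hγ])
  set Mη : ℝ := (Cmax + Cmax) * Mw with hMη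
  have hnoise_bd : ∀ a b : ℝ, a ≤ 2 * T → b ≤ 2 * T → ∀ ω ∈ goodEvent Mw r', ∀ s ∈ Icc (0 : ℝ) r,
      ‖chainNoise N (c a) (c b) (pairPath ω) s‖ ≤ Mη := by
    intro a b ha hb ω hω s hs
    have h := norm_chainNoise_sub_le (N := N) hω (c a) (c b) 0 0 (s := s) (by rw [hr'c]; exact hs.2)
    have h0 : chainNoise N 0 0 (pairPath ω) s = 0 := by
      funext i; simp [chainNoise]
    rw [h0, sub_zero, sub_zero, sub_zero] at h
    refine h.trans (mul_le_mul_of_nonneg_right (add_le_add (hcle a ha) (hcle b hb)) hMw0)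
  -- continuity of the flow in the noise path, uniformly on the energy shell
  obtain ⟨δ₁, hδ₁, hflow⟩ := pinnedChain_exists_norm_chainFlow_sub_lt hω hl hβ hγ N R Mη r hε₁
  -- continuity of the amplitudes at `δ = 0`
  set φ : ℝ → ℝ := fun δ => (|c (T + δ / 2) - c T| + |c (T - δ / 2) - c T|) * Mw with hφ
  have hφc : Continuous φ := by
    have h1 : Continuous fun δ : ℝ => c (T + δ / 2) :=
      Real.continuous_sqrt.comp (continuous_const.mul (continuous_const.add (continuous_id.div_const _)))
    have h2 : Continuous fun δ : ℝ => c (T - δ / 2) :=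
      Real.continuous_sqrt.comp (continuous_const.mul (continuous_const.sub (continuous_id.div_const _)))
    exact (((h1.sub continuous_const).abs).add ((h2.sub continuous_const).abs)).mul continuous_const
  have hφ0 : φ 0 = 0 := by simp [hφ]
  obtain ⟨δ₂, hδ₂, hδ₂φ⟩ := Metric.continuousAt_iff.1 hφc.continuousAt δ₁ hδ₁
  refine ⟨min δ₂ T, lt_min hδ₂ hT, fun δ hδ z hz => ?_⟩
  have hδ₂' : |δ| < δ₂ := hδ.trans_le (min_le_left _ _)
  have hδT : |δ| < T := hδ.trans_le (min_le_right _ _)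
  have hφδ : φ δ < δ₁ := by
    have h := hδ₂φ (x := δ) (by rwa [Real.dist_eq, sub_zero])
    rwa [Real.dist_eq, hφ0, sub_zero, abs_of_nonneg] at h
    simp only [hφ]; positivity
  have haT : T + δ / 2 ≤ 2 * T := by linarith only [(abs_lt.1 hδT).2, hT]
  have hbT : T - δ / 2 ≤ 2 * T := by linarith only [(abs_lt.1 hδT).1, hT]
  have hTT : T ≤ 2 * T := by linarith only [hT]
  -- the two integrands
  set Fδ : WienerPair → ℝ := fun ω => g (P.solMap N (T + δ / 2) (T - δ / 2) r z (pairPath ω)) with hFδ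
  set F0 : WienerPair → ℝ := fun ω => g (P.solMap N T T r z (pairPath ω)) with hF0
  have hFδm : AEStronglyMeasurable Fδ wienerPair :=
    (hg.measurable.comp (pinnedChain_measurable_solMap_pairPath_right hω hl hβ hγ N _ _ r z)).aestronglyMeasurable
  have hF0m : AEStronglyMeasurable F0 wienerPair :=
    (hg.measurable.comp (pinnedChain_measurable_solMap_pairPath_right hω hl hβ hγ N _ _ r z)).aestronglyMeasurable
  have hFδi : Integrable Fδ wienerPair := (integrable_const G).mono' hFδm
    (Eventually.of_forall fun ω => by rw [Real.norm_eq_abs]; exact hG _)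
  have hF0i : Integrable F0 wienerPair := (integrable_const G).mono' hF0m
    (Eventually.of_forall fun ω => by rw [Real.norm_eq_abs]; exact hG _)
  -- pointwise bound: `ε/2` on the good event, `2G` off it
  have hpt : ∀ ω, ‖Fδ ω - F0 ω‖ ≤ ε / 2 + bad.indicator (fun _ => 2 * G) ω := by
    intro ω
    by_cases hωg : ω ∈ goodEvent Mw r'
    · have hnb : ω ∉ bad := fun h => h hωg
      rw [Set.indicator_of_notMem hnb, add_zero]
      -- the flows are `ε₁`-close at time `r`
      have hη₁c := continuous_chainNoise (N := N) (c (T + δ / 2)) (c (T - δ / 2)) (pairPath ω)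
      have hη₂c := continuous_chainNoise (N := N) (c T) (c T) (pairPath ω)
      have hdiff : ∀ s ∈ Icc (0 : ℝ) r, ‖chainNoise N (c (T + δ / 2)) (c (T - δ / 2)) (pairPath ω) s -
          chainNoise N (c T) (c T) (pairPath ω) s‖ ≤ δ₁ := fun s hs =>
        (norm_chainNoise_sub_le (N := N) hωg _ _ _ _ (s := s) (by rw [hr'c]; exact hs.2)).trans hφδ.le
      have hcl := hflow z hz _ _ hη₁c hη₂c (hnoise_bd _ _ haT hbT ω hωg) (hnoise_bd _ _ hTT hTT ω hωg) hdiff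
        r ⟨hr, le_rfl⟩
      have hsol1 : P.solMap N (T + δ / 2) (T - δ / 2) r z (pairPath ω) =
          P.chainFlow N z (chainNoise N (c (T + δ / 2)) (c (T - δ / 2)) (pairPath ω)) r := rfl
      have hsol2 : P.solMap N T T r z (pairPath ω) = P.chainFlow N z (chainNoise N (c T) (c T) (pairPath ω)) r := rfl
      have hd : dist (P.solMap N (T + δ / 2) (T - δ / 2) r z (pairPath ω)) (P.solMap N T T r z (pairPath ω)) < ε₁ := by
        rw [dist_eq_norm, hsol1, hsol2]; exact hcl
      have := hε₁g hd
      rw [Real.dist_eq] at this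
      simpa [hFδ, hF0, Real.norm_eq_abs] using this.le
    · have hb : ω ∈ bad := hωg
      rw [Set.indicator_of_mem hb]
      calc ‖Fδ ω - F0 ω‖ ≤ ‖Fδ ω‖ + ‖F0 ω‖ := norm_sub_le _ _
        _ ≤ G + G := add_le_add (by rw [Real.norm_eq_abs]; exact hG _) (by rw [Real.norm_eq_abs]; exact hG _)
        _ ≤ ε / 2 + 2 * G := by linarith only [hε]
  -- integrate
  rw [← Real.norm_eq_abs, ← integral_sub hFδi hF0i]
  have hbi : Integrable (bad.indicator fun _ : WienerPair => (2 * G : ℝ)) wienerPair :=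
    (integrable_const (2 * G)).indicator hbadm
  calc ‖∫ ω, (Fδ ω - F0 ω) ∂wienerPair‖ ≤ ∫ ω, ‖Fδ ω - F0 ω‖ ∂wienerPair := norm_integral_le_integral_norm _
    _ ≤ ∫ ω, (ε / 2 + bad.indicator (fun _ => 2 * G) ω) ∂wienerPair :=
        integral_mono_of_nonneg (Eventually.of_forall fun ω => norm_nonneg _) ((integrable_const _).add hbi)
          (Eventually.of_forall hpt)
    _ = ε / 2 + wienerPair.real bad * (2 * G) := by
        rw [integral_add (integrable_const _) hbi, integral_const, probReal_univ, one_smul,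
          integral_indicator_const _ hbadm, smul_eq_mul]
    _ ≤ ε / 2 + η * (2 * G) := by gcongr
    _ ≤ ε := by
        rw [hηdef]
        have h1 : ε / (4 * (G + 1)) * (2 * G) ≤ ε / 2 := by
          rw [div_mul_eq_mul_div, div_le_div_iff₀ (by positivity) (by positivity)]
          nlinarith only [hε, hG0]
        linarith only [h1]

end Summit.AtomisticToContinuum.FouriersLaw.Theorems.LinearResponseFTUR

end
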